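import Literature.Geometry.Lorentzian.GeodesicSpeed
import Literature.Geometry.Lorentzian.CoordinateFrames
import Mathlib.Geometry.Manifold.VectorField.Pullback
import HarnessLib

/-!
# Killing fields straightened by a chart: the metric components are constant along the field
(step 1 of Müller zum Hagen's analyticity theorem: "comoving coordinates")

Support file (everything proved, no definitions, no named facts) for the named fact
`Literature.Geometry.Lorentzian.mullerZumHagen1970_analytic_of_timelikeKilling`
(`MullerZumHagenAnalyticity.lean`). The printed proof (H. Müller zum Hagen, Proc. Camb. Phil.
Soc. 68 (1970) 199–201; restated as Thm. 3.1 of P. Tod, Gen. Rel. Grav. 39 (2007) 1031 =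
arXiv:0704.2508, §3.1) begins with **comoving coordinates**: near a point where the Killing field
`K` does not vanish there is a chart in which `K = ∂_t` and all metric components are independent
of `t`. The chart is the flow box of `K` (`Literature.Geometry.Manifold.exists_chart_mfderiv_eq_const`,
Lee 2012, Thm. 9.22); this file supplies the second half, for a manifold modelled on the normed
space `E` itself (`𝓘(ℝ, E)`, e.g. `𝓡 4`):

* `mpullback_const_apply_of_mem_maximalAtlas`, `mdifferentiableAt_mpullback_const`,
  `mlieBracket_mpullback_const` — the coordinate fields `∂_a = dψ⁻¹(a)` of a chart `ψ` of the
  maximal `C^∞` atlas are the pullbacks of the constant fields, are differentiable, and commute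
  (O'Neill 1983, Ch. 1, Lemma 1.18 ff.; Mathlib's `VectorField.mpullback_mlieBracket`);
* `PseudoRiemannianMetric.hasDerivAt_val_coordVector_of_killing_at` — **if `K = ∂_c` in the chart
  `ψ` (i.e. `K = dψ⁻¹(c)` on `ψ.source`) and `K` satisfies the Killing equation
  `g(∇_v K, w) + g(v, ∇_w K) = 0` at `x ∈ ψ.source`, then every metric component
  `t ↦ g_{ψ⁻¹(ψ x + t c)}(∂_a, ∂_b)` has derivative `0` at `t = 0`** (O'Neill 1983, Ch. 9,
  Prop. 9.23/9.25: `K g(∂_a, ∂_b) = g(∇_K ∂_a, ∂_b) + g(∂_a, ∇_K ∂_b)` (compatibility),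
  `∇_K ∂_a = ∇_{∂_a} K + [K, ∂_a]` (no torsion), `[∂_c, ∂_a] = 0`, and the Killing equation).

## References

* H. Müller zum Hagen, Proc. Camb. Phil. Soc. 68 (1970) 199–201. [MullerZumHagen1970]
* P. Tod, Gen. Rel. Grav. 39 (2007), Thm. 3.1 (arXiv:0704.2508, §3.1).
* B. O'Neill, *Semi-Riemannian geometry*, Academic Press 1983, Ch. 1, Lemma 1.18 ff.; Ch. 9,
  Prop. 9.23, Prop. 9.25. [ONeill1983]
-/

noncomputable section

open Bundle Set Filter Function VectorField
open scoped Manifold ContDiff Topology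

namespace Literature.Geometry.Lorentzian

variable {E : Type*} [NormedAddCommGroup E] [NormedSpace ℝ E] [CompleteSpace E]
  {M : Type*} [TopologicalSpace M] [ChartedSpace E M] [IsManifold 𝓘(ℝ, E) ∞ M]

/-! ### Coordinate vector fields of a chart of the maximal atlas -/

section CoordVector

omit [CompleteSpace E] [IsManifold 𝓘(ℝ, E) ∞ M] in
/-- A chart of the maximal `C^∞` atlas is differentiable with differentiable inverse (Mathlib's
`OpenPartialHomeomorph.MDifferentiable`). [folklore] -/
theorem mdifferentiable_of_mem_maximalAtlas' {ψ : OpenPartialHomeomorph M E}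
    (hψ : ψ ∈ IsManifold.maximalAtlas 𝓘(ℝ, E) ∞ M) : ψ.MDifferentiable 𝓘(ℝ, E) 𝓘(ℝ, E) :=
  ⟨(contMDiffOn_of_mem_maximalAtlas hψ).mdifferentiableOn (by simp),
    (contMDiffOn_symm_of_mem_maximalAtlas hψ).mdifferentiableOn (by simp)⟩

omit [CompleteSpace E] [IsManifold 𝓘(ℝ, E) ∞ M] in
/-- **The coordinate vector fields of a chart are the pulled-back constant fields**: for a chart
`ψ` of the maximal `C^∞` atlas and `z ∈ ψ.source`, the pullback along `ψ` of the constant field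
`a` is `∂_a|_z = d(ψ⁻¹)_{ψ z} a`. O'Neill 1983, Ch. 1, Def. 1.9 ff. [cite: ONeill1983, Ch. 1, Def. 1.9 ff] -/
theorem mpullback_const_apply_of_mem_maximalAtlas {ψ : OpenPartialHomeomorph M E}
    (hψ : ψ ∈ IsManifold.maximalAtlas 𝓘(ℝ, E) ∞ M) {z : M} (hz : z ∈ ψ.source) (a : E) :
    mpullback 𝓘(ℝ, E) 𝓘(ℝ, E) ψ (fun _ ↦ a) z = mfderiv 𝓘(ℝ, E) 𝓘(ℝ, E) ψ.symm (ψ z) a := by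
  have hd := mdifferentiable_of_mem_maximalAtlas' hψ
  have h : mfderiv 𝓘(ℝ, E) 𝓘(ℝ, E) ψ z = ((hd.mfderiv hz : _ ≃L[ℝ] _) : _ →L[ℝ] _) := by
    ext v
    rfl
  rw [mpullback_apply, h, ContinuousLinearMap.inverse_equiv]
  rfl

omit [CompleteSpace E] [IsManifold 𝓘(ℝ, E) ∞ M] in
/-- The differential of a chart of the maximal atlas at a point of its source is invertible.
[folklore] -/
theorem isInvertible_mfderiv_of_mem_maximalAtlas {ψ : OpenPartialHomeomorph M E}
    (hψ : ψ ∈ IsManifold.maximalAtlas 𝓘(ℝ, E) ∞ M) {z : M} (hz : z ∈ ψ.source) :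
    (mfderiv 𝓘(ℝ, E) 𝓘(ℝ, E) ψ z).IsInvertible :=
  ⟨(mdifferentiable_of_mem_maximalAtlas' hψ).mfderiv hz, by ext v; rfl⟩

/-- The coordinate vector fields `∂_a` of a chart of the maximal `C^∞` atlas are differentiable
on the chart domain (pullback of a smooth field by a `C^∞` map with invertible differential,
Mathlib's `MDifferentiableAt.mpullback_vectorField`). [folklore] -/
theorem mdifferentiableAt_mpullback_const {ψ : OpenPartialHomeomorph M E}
    (hψ : ψ ∈ IsManifold.maximalAtlas 𝓘(ℝ, E) ∞ M) {z : M} (hz : z ∈ ψ.source) (a : E) :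
    MDiffAt (T% (mpullback 𝓘(ℝ, E) 𝓘(ℝ, E) ψ (fun _ ↦ a))) z :=
  MDifferentiableAt.mpullback_vectorField
    (((contMDiffAt_vectorSpace_iff_contDiffAt (𝕜 := ℝ)
      (V := fun x : E ↦ (a : TangentSpace 𝓘(ℝ, E) x)) (n := 1) (x := ψ z)).2
        contDiffAt_const).mdifferentiableAt one_ne_zero)
    ((contMDiffOn_of_mem_maximalAtlas hψ).contMDiffAt (ψ.open_source.mem_nhds hz))
    (isInvertible_mfderiv_of_mem_maximalAtlas hψ hz) ENat.LEInfty.out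

/-- **The coordinate vector fields of a chart commute**, `[∂_a, ∂_b] = 0` on the chart domain
(O'Neill 1983, Ch. 1, Lemma 1.18 ff.): pullback along the `C^∞` chart commutes with the bracket
(Mathlib's `VectorField.mpullback_mlieBracket`) and constant fields commute
(`mlieBracket_const_const`). [cite: ONeill1983, Ch. 1, Lemma 1.18 ff] -/
theorem mlieBracket_mpullback_const {ψ : OpenPartialHomeomorph M E}
    (hψ : ψ ∈ IsManifold.maximalAtlas 𝓘(ℝ, E) ∞ M) {z : M} (hz : z ∈ ψ.source) (a b : E) :
    mlieBracket 𝓘(ℝ, E) (mpullback 𝓘(ℝ, E) 𝓘(ℝ, E) ψ (fun _ ↦ a))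
      (mpullback 𝓘(ℝ, E) 𝓘(ℝ, E) ψ (fun _ ↦ b)) z = 0 := by
  haveI : IsManifold 𝓘(ℝ, E) (minSmoothness ℝ 2) M := by
    rw [minSmoothness_of_isRCLikeNormedField]; infer_instance
  have hc := fun u : E ↦ ((contMDiffAt_vectorSpace_iff_contDiffAt (𝕜 := ℝ)
    (V := fun x : E ↦ (u : TangentSpace 𝓘(ℝ, E) x)) (n := 1) (x := ψ z)).2
      contDiffAt_const).mdifferentiableAt one_ne_zero
  rw [← mpullback_mlieBracket (hc a) (hc b)
      ((contMDiffOn_of_mem_maximalAtlas hψ).contMDiffAt (ψ.open_source.mem_nhds hz))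
      (by rw [minSmoothness_of_isRCLikeNormedField]; exact WithTop.coe_le_coe.2 le_top),
    mlieBracket_const_const, mpullback_zero]
  rfl

end CoordVector

/-! ### Metric components along a straightened Killing field -/

namespace PseudoRiemannianMetric

variable [FiniteDimensional ℝ E] {n : ℕ∞ω} [Fact (1 ≤ n)]
  {g : PseudoRiemannianMetric 𝓘(ℝ, E) n E (TangentSpace 𝓘(ℝ, E) : M → Type _)} [g.HasLeviCivita]

omit [CompleteSpace E] [IsManifold 𝓘(ℝ, E) ∞ M] [FiniteDimensional ℝ E] in
/-- Chain rule for velocities (private copy of `velocity_comp` of `GaussFormulaTangential.lean`,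
to keep the imports light). [folklore] -/
private theorem velocity_comp'' {γ : ℝ → E} {f : E → M} {t : ℝ}
    (hf : MDifferentiableAt 𝓘(ℝ, E) 𝓘(ℝ, E) f (γ t)) (hγ : MDifferentiableAt 𝓘(ℝ, ℝ) 𝓘(ℝ, E) γ t) :
    velocity 𝓘(ℝ, E) (f ∘ γ) t = mfderiv 𝓘(ℝ, E) 𝓘(ℝ, E) f (γ t) (velocity 𝓘(ℝ, E) γ t) := by
  unfold velocity
  rw [mfderiv_comp t hf hγ]
  rfl

omit [CompleteSpace E] [FiniteDimensional ℝ E] in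
/-- The velocity of the straight line `t ↦ q + t • c` of `E` is `c`. [folklore] -/
private theorem velocity_line (q c : E) (t : ℝ) :
    velocity 𝓘(ℝ, E) (fun s : ℝ ↦ q + s • c) t = c := by
  have h : HasDerivAt (fun s : ℝ ↦ q + s • c) c t := by
    simpa using ((hasDerivAt_id t).smul_const c).const_add q
  unfold velocity
  rw [mfderiv_eq_fderiv, ← toSpanSingleton_deriv, h.deriv]
  exact one_smul ℝ c

omit [CompleteSpace E] [IsManifold 𝓘(ℝ, E) ∞ M] [FiniteDimensional ℝ E] in
/-- The differential of `ψ⁻¹` applied to a fixed vector, at equal points (a cross-fibre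
rewriting helper). [folklore] -/
private theorem mfderiv_symm_congr_point (ψ : OpenPartialHomeomorph M E) {p p' : E} (h : p = p')
    (w : E) :
    mfderiv 𝓘(ℝ, E) 𝓘(ℝ, E) ψ.symm p w = mfderiv 𝓘(ℝ, E) 𝓘(ℝ, E) ψ.symm p' w := by
  subst h
  rfl

/-- **Metric components are constant along a straightened Killing field** (step 1 of Müller zum
Hagen 1970 — Tod 2007, Thm. 3.1 "comoving coordinates": `g = F(dt + A_i dx^i)² − h_{ij}dx^i dx^j`
with `F, A_i, h_{ij}` independent of `t`; O'Neill 1983, Ch. 9, Prop. 9.23 and 9.25). Let `ψ` be a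
chart of the maximal `C^∞` atlas in which the vector field `K` is the coordinate field `∂_c`,
`K z = d(ψ⁻¹)_{ψ z} c` for `z ∈ ψ.source`, and let `K` satisfy the Killing equation
`g(∇_v K, w) + g(v, ∇_w K) = 0` at the point `x ∈ ψ.source`. Then for all `a, b ∈ E` the metric
component `t ↦ g_{ψ⁻¹(ψ x + t c)}(∂_a, ∂_b)` has derivative `0` at `t = 0`. Proof as printed:
`∂_c g(∂_a, ∂_b) = g(∇_{∂_c} ∂_a, ∂_b) + g(∂_a, ∇_{∂_c} ∂_b)` (metric compatibility along the
`c`-coordinate line), `∇_{∂_c} ∂_a = ∇_{∂_a} ∂_c + [∂_c, ∂_a] = ∇_{∂_a} K` (no torsion, coordinate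
fields commute), and the Killing equation at `x`. [cite: MullerZumHagen1970, Theorem (comoving coordinates; Tod 2007 Thm. 3.1)] -/
theorem hasDerivAt_val_coordVector_of_killing_at
    {ψ : OpenPartialHomeomorph M E} (hψ : ψ ∈ IsManifold.maximalAtlas 𝓘(ℝ, E) ∞ M)
    {K : Π x : M, TangentSpace 𝓘(ℝ, E) x} {c : E}
    (hK : ∀ z ∈ ψ.source, mfderiv 𝓘(ℝ, E) 𝓘(ℝ, E) ψ.symm (ψ z) c = K z)
    {x : M} (hx : x ∈ ψ.source)
    (hKill : ∀ v w : TangentSpace 𝓘(ℝ, E) x,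
      g.val x (g.leviCivita K x v) w + g.val x v (g.leviCivita K x w) = 0)
    (a b : E) :
    HasDerivAt (fun t : ℝ ↦ g.val (ψ.symm (ψ x + t • c))
      (mfderiv 𝓘(ℝ, E) 𝓘(ℝ, E) ψ.symm (ψ x + t • c) a)
      (mfderiv 𝓘(ℝ, E) 𝓘(ℝ, E) ψ.symm (ψ x + t • c) b)) 0 0 := by
  have hLC : g.IsLeviCivita g.leviCivita := isLeviCivita_leviCivita_holds
  haveI : IsManifold 𝓘(ℝ, E) 2 M := IsManifold.of_le (n := ∞) ENat.LEInfty.out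
  have hd := mdifferentiable_of_mem_maximalAtlas' hψ
  -- the coordinate fields `∂_w`
  set V : E → Π z : M, TangentSpace 𝓘(ℝ, E) z :=
    fun w ↦ mpullback 𝓘(ℝ, E) 𝓘(ℝ, E) ψ (fun _ ↦ w) with hV
  have hVeq : ∀ w, ∀ z ∈ ψ.source, V w z = mfderiv 𝓘(ℝ, E) 𝓘(ℝ, E) ψ.symm (ψ z) w :=
    fun w z hz ↦ mpullback_const_apply_of_mem_maximalAtlas hψ hz w
  have hVd : ∀ w, ∀ z ∈ ψ.source, MDiffAt (T% (V w)) z :=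
    fun w z hz ↦ mdifferentiableAt_mpullback_const hψ hz w
  have hbr : ∀ v w, ∀ z ∈ ψ.source, mlieBracket 𝓘(ℝ, E) (V v) (V w) z = 0 :=
    fun v w z hz ↦ mlieBracket_mpullback_const hψ hz v w
  -- `K = ∂_c` near `x`; `K` is differentiable at `x`
  have hKV : ∀ᶠ z in 𝓝 x, V c z = K z := by
    filter_upwards [ψ.open_source.mem_nhds hx] with z hz
    rw [hVeq c z hz, hK z hz]
  have hKx : V c x = K x := hKV.self_of_nhds
  have hKd : MDiffAt (T% K) x := by
    refine (hVd c x hx).congr_of_eventuallyEq ?_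
    filter_upwards [hKV] with z hz
    rw [hz]
  -- no torsion and `[∂_c, ∂_w] = 0`: `∇_{∂_c} ∂_w = ∇_{∂_w} ∂_c = ∇_{∂_w} K` at `x`
  have htor : ∀ w, g.leviCivita (V w) x (V c x) = g.leviCivita K x (V w x) := by
    intro w
    have h := (g.leviCivita.torsion_eq_zero_iff).1 hLC.1 (hVd c x hx) (hVd w x hx)
    rw [hbr c w x hx] at h
    have h' : g.leviCivita (V w) x (V c x) = g.leviCivita (V c) x (V w x) := sub_eq_zero.1 h
    rw [h', g.leviCivita.isCovariantDerivativeOn.congr_of_eventuallyEq (hVd c x hx) hKd univ_mem hKV]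
  -- the `c`-coordinate line through `x` and its velocity
  set q : E := ψ x with hq
  have hqt : q ∈ ψ.target := ψ.map_source hx
  set γ : ℝ → M := fun t ↦ ψ.symm (q + t • c) with hγ
  have hγ0 : γ 0 = x := by simp [hγ, hq, ψ.left_inv hx]
  have hLd : ∀ t, MDifferentiableAt 𝓘(ℝ, ℝ) 𝓘(ℝ, E) (fun s : ℝ ↦ q + s • c) t := fun t ↦
    mdifferentiableAt_iff_differentiableAt.mpr (by fun_prop)
  have hψd0 : MDifferentiableAt 𝓘(ℝ, E) 𝓘(ℝ, E) ψ.symm (q + (0 : ℝ) • c) := by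
    rw [zero_smul, add_zero]
    exact hd.mdifferentiableAt_symm hqt
  have hγd : MDifferentiableAt 𝓘(ℝ, ℝ) 𝓘(ℝ, E) γ 0 := hψd0.comp 0 (hLd 0)
  have hγvel : velocity 𝓘(ℝ, E) γ 0 = K x := by
    have h1 := velocity_comp'' (f := ψ.symm) (γ := fun s : ℝ ↦ q + s • c) hψd0 (hLd 0)
    rw [velocity_line, mfderiv_symm_congr_point ψ (show q + (0 : ℝ) • c = ψ x by simp [hq]) c,
      hK x hx] at h1
    exact h1
  -- the fields `∂_a ∘ γ`, `∂_b ∘ γ` along `γ` have differentiable lifts at `0`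
  have hlift : ∀ w, MDifferentiableAt 𝓘(ℝ, ℝ) (𝓘(ℝ, E).tangent)
      (fun t ↦ (TotalSpace.mk' E (γ t) (V w (γ t)) : TangentBundle 𝓘(ℝ, E) M)) 0 := by
    intro w
    have h : MDiffAt (T% (V w)) (γ 0) := by rw [hγ0]; exact hVd w x hx
    exact h.comp 0 hγd
  -- compatibility along `γ`: `(d/dt) g(∂_a, ∂_b) = g(D_t ∂_a, ∂_b) + g(∂_a, D_t ∂_b)`
  have hD := hasDerivAt_val_apply_along (g := g) hLC.2 (hlift a) (hlift b)
  -- `D_t (∂_w ∘ γ) = ∇_{γ'} ∂_w = ∇_K ∂_w`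
  have hcomp : ∀ w, covariantDerivAlong g.leviCivita γ (fun t ↦ V w (γ t)) 0 =
      g.leviCivita (V w) (γ 0) (velocity 𝓘(ℝ, E) γ 0) := fun w ↦
    covariantDerivAlong_comp_holds g.leviCivita hγd (by rw [hγ0]; exact hVd w x hx)
  rw [hcomp a, hcomp b, hγvel] at hD
  -- the derivative vanishes by the Killing equation
  have hzero : g.val (γ 0) (g.leviCivita (V a) (γ 0) (K x)) (V b (γ 0)) +
      g.val (γ 0) (V a (γ 0)) (g.leviCivita (V b) (γ 0) (K x)) = 0 := by
    rw [hγ0, ← hKx, htor a, htor b]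
    exact hKill (V a x) (V b x)
  rw [hzero] at hD
  -- the statement's function agrees with `t ↦ g(∂_a, ∂_b)(γ t)` near `t = 0`
  refine hD.congr_of_eventuallyEq ?_
  have hcont : Continuous fun s : ℝ ↦ q + s • c := by fun_prop
  have hmem : {s : ℝ | q + s • c ∈ ψ.target} ∈ 𝓝 (0 : ℝ) :=
    (ψ.open_target.preimage hcont).mem_nhds (by simpa using hqt)
  filter_upwards [hmem] with s hs
  have hsrc : ψ.symm (q + s • c) ∈ ψ.source := ψ.map_target hs
  show g.val (ψ.symm (q + s • c)) (mfderiv 𝓘(ℝ, E) 𝓘(ℝ, E) ψ.symm (q + s • c) a)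
      (mfderiv 𝓘(ℝ, E) 𝓘(ℝ, E) ψ.symm (q + s • c) b) =
    g.val (ψ.symm (q + s • c)) (V a (ψ.symm (q + s • c))) (V b (ψ.symm (q + s • c)))
  rw [hVeq a _ hsrc, hVeq b _ hsrc, mfderiv_symm_congr_point ψ (ψ.right_inv hs) a,
    mfderiv_symm_congr_point ψ (ψ.right_inv hs) b]

end PseudoRiemannianMetric

end Literature.Geometry.Lorentzian
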